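import Summits.ResolutionOfSingularities.ResolutionOfSingularities.Theorems.HilbertSamuelEliminationSigmaMaxModificationsCorridor3WLadderForcedGameTowers
import Summits.ResolutionOfSingularities.ResolutionOfSingularities.Theorems.HilbertSamuelEliminationSigmaMaxModificationsCorridor3WLadderForcedGameAlgebra
import Summits.ResolutionOfSingularities.ResolutionOfSingularities.Theorems.HilbertSamuelEliminationSigmaMaxModificationsCorridor3WLadderForcedGameTerminates
import Summits.ResolutionOfSingularities.ResolutionOfSingularities.Theorems.HilbertSamuelEliminationSigmaMaxModificationsCorridor3WLadderMovingIso
import Literature.Combinatorics.HironakaPolyhedraGame.Spivakovsky1983Proof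
import HarnessLib

/-!
# [OURS · L1 W4.2] MODULE `Corridor3WLadderForcedGameTowersJoin` (crux chain w42, idea-1 card C4 `forced-hironaka-game-iso-vertices`)
# — part 3: the JOINS BY NAME of the landed C4 pieces (the honest floor of the card in one line each)

D2 after-care (typer res-type-012; res-L1-w42-plan-1 «W4.2 DEAL» 2026-08-27T07:34:07Z D2, RULINGS v3.12-1 (G) «C4 consumes whichever
closes `forcedGameTerminates` first», v3.12-3 (Q) «FRAME partition k1/k2/k3: vertex `C4` = D2 + D4 + D5 + K-FORCED … PROVED joins,
NEITHER a skeleton item (second layer, consumed BY NAME through `wtopEvIsoM_of_towers`)», v3.12-4 (U) «C4 JOIN = ONE FILE = res-type-012's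
part 3 … include res-type-022's unconditional `isoVertexChainImpossible_holds` WITH ATTRIBUTION»).  Inputs, all LANDED and cited BY NAME:
D2 `…ForcedGameTowersDefs` / `…ForcedGameTowers` (p513199 / p514246: `isoVertexTowersImpossible_of`,
`isoQuadraticTowerTerminates_of_vertex_translation`, `isoQuadraticTowerTerminates_of_forcedGame`), D5 `…ForcedGameAlgebra` (res-D-pv-010,
p514238: `pairConditionOfAlgIsolated`, `isoVertexChainImpossible_of_forcedGameTerminates`), K-FORCED `…ForcedGameTerminates` (res-type-022,
p513548 + p514574: `forcedGameTerminates_holds` — the forced polyhedra game terminates in EVERY dimension, UNCONDITIONALLY, no Spivakovsky),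
the DISCHARGED Literature fact `Spivakovsky1983_winningStrategy_holds` (res-D-pv-044, p515722; statement file res-type-004 p511596), and r4's
`wtopEvIsoM_of_towers` (`…Corridor3WLadderMovingIso`, p501384).  What this part records:

* `isoVertexChainImpossible_holds : IsoVertexChainImpossible` — NO iso-admissible origin-chart chain exists, UNCONDITIONALLY (res-type-022's
  `forcedGameTerminates_holds 3` fed to res-D-pv-010's `isoVertexChainImpossible_of_forcedGameTerminates`; attribution theirs, the line is glue);

* `isoVertexTowersImpossible_of_algIsolated : AlgIsolatedOfIsolated → IsoVertexTowersImpossible` — T2 (no iso point tower with excellent first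
  stage has a vertex-chained tail) holds MODULO P1 ALONE (K-FORCED ∘ D5 ∘ D2);
* `isoQuadraticTowerTerminates_of_algIsolated : AlgIsolatedOfIsolated → IsoTranslationTowersImpossible p → IsoQuadraticTowerTerminates p 3` —
  THE KERNEL of the W-top isolated half modulo exactly {P1 (M+, not dealt), T3 (the residual OPEN core)} — the honest floor of card C4;
* `isoQuadraticTowerTerminates_of_spivakovsky` — the printed route for the record: the same through Spivakovsky's theorem, the Literature fact
  `Spivakovsky1983_winningStrategy` (DEAL D4, res-type-004, p511596) now DISCHARGED (`Spivakovsky1983_winningStrategy_holds`, res-D-pv-044,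
  p515722), in place of K-FORCED — so this twin, too, is hypothesis-free but for {P1, T3};
* `wtopEvIsoM_of_algIsolated` — one storey up: r4's row `WtopEvIsoM p Q` (no moving E3 chain eventually isolated) for EVERY origin
  predicate `Q`, modulo {P1, T3, `IsoTailTowerExtractionM p` (DEAL D7)}.

Everything here is a CONDITIONAL join and credits nothing toward the crux (helper lemmas, `--supports stmt-…-19249 --as helper`, counted 0;
card C4 = SURVIVES-MODULO, tri-1/tri-2 TRIAGE r6).  OURS; NOT statements of [CossartJannsenSaito2020], [Spivakovsky1983] nor of the manuscript
[Hironaka2017]; AI typing, weaker than expert review.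
-/

set_option linter.dupNamespace false
set_option autoImplicit false

noncomputable section

namespace Summit.ResolutionOfSingularities.ResolutionOfSingularities.Cruxes.SigmaMaxModifications.IdeasL1C4

open Summit.ResolutionOfSingularities.ResolutionOfSingularities.Cruxes.SigmaMaxModifications.IdeasL1Idea2R4
open Summit.ResolutionOfSingularities.ResolutionOfSingularities.Theorems.SigmaMaxModificationsCorridor3.Moving
open Literature.Combinatorics.HironakaPolyhedraGame

universe u

/-- **NO ISO-ADMISSIBLE ORIGIN-CHART CHAIN — UNCONDITIONALLY** (C4 §2's `IsoVertexChainImpossible` is a theorem): the forced polyhedra game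
terminates in every dimension (res-type-022, K-FORCED, `forcedGameTerminates_holds`, p513548 + p514574 — a direct particle-system proof, no
Spivakovsky), and an iso-admissible origin-chart chain would sandwich an infinite forced play (res-D-pv-010, D5,
`isoVertexChainImpossible_of_forcedGameTerminates`, p514238).  This line is glue; the mathematics is theirs.  OURS; not a citation of print. -/
theorem isoVertexChainImpossible_holds : IsoVertexChainImpossible :=
  isoVertexChainImpossible_of_forcedGameTerminates (forcedGameTerminates_holds 3)

/-- **T2 modulo P1 alone**: an iso point tower with excellent first stage has no vertex-chained tail, GIVEN only the isolation transfer
`AlgIsolatedOfIsolated` (P1) — the forced game terminates unconditionally (res-type-022 `forcedGameTerminates_holds`), whence no iso-admissible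
origin-chart chain (res-D-pv-010 `isoVertexChainImpossible_of_forcedGameTerminates`), and the pair condition is res-D-pv-010's
`pairConditionOfAlgIsolated`.  OURS join; not a citation of print. -/
theorem isoVertexTowersImpossible_of_algIsolated (hP1 : AlgIsolatedOfIsolated.{u}) : IsoVertexTowersImpossible.{u} :=
  isoVertexTowersImpossible_of isoVertexChainImpossible_holds pairConditionOfAlgIsolated hP1

/-- **THE KERNEL MODULO {P1, T3}** — the honest floor of card C4: over a maximal origin of characteristic `p` there is no infinite isolated
E3 point tower, GIVEN the isolation transfer P1 and the residual translation-recurrent core T3 `IsoTranslationTowersImpossible p`.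
OURS join; not a citation of print. -/
theorem isoQuadraticTowerTerminates_of_algIsolated (p : ℕ) (hP1 : AlgIsolatedOfIsolated.{u})
    (h3 : IsoTranslationTowersImpossible.{u} p) : IsoQuadraticTowerTerminates.{u} p 3 :=
  isoQuadraticTowerTerminates_of_vertex_translation p (isoVertexTowersImpossible_of_algIsolated hP1) h3

/-- **The printed route, for the record**: the same kernel reduction through Spivakovsky's theorem — player A wins Hironaka's polyhedra
game positionally, in every dimension: the Literature fact `Spivakovsky1983_winningStrategy` (res-type-004), DISCHARGED as
`Spivakovsky1983_winningStrategy_holds` (res-D-pv-044) — in place of the unconditional `forcedGameTerminates_holds`.  OURS join.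
[cite: Spivakovsky1983, Theorem p. 420 and Remark 1 (pointer)] -/
theorem isoQuadraticTowerTerminates_of_spivakovsky (p : ℕ) (hP1 : AlgIsolatedOfIsolated.{u})
    (h3 : IsoTranslationTowersImpossible.{u} p) : IsoQuadraticTowerTerminates.{u} p 3 :=
  isoQuadraticTowerTerminates_of_forcedGame p (Spivakovsky1983_winningStrategy_holds 3)
    isoVertexChainImpossible_of_forcedGameTerminates pairConditionOfAlgIsolated hP1 h3

/-- **One storey up — r4's Ev-Iso row modulo {P1, T3, extraction}**: for every origin predicate `Q`, no moving E3 chain from a `Q`-maximal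
origin of characteristic `p` is eventually isolated at every stage, GIVEN P1, T3 and the isolated-tail tower extraction
`IsoTailTowerExtractionM p` (DEAL D7), by r4's PROVED `wtopEvIsoM_of_towers` (p501384).  OURS join; not a citation of print. -/
theorem wtopEvIsoM_of_algIsolated (p : ℕ) (hP1 : AlgIsolatedOfIsolated.{u}) (h3 : IsoTranslationTowersImpossible.{u} p)
    (hext : IsoTailTowerExtractionM.{u} p) (Q : ℕ → (ℕ → ℕ) → ∀ X : AlgebraicGeometry.Scheme.{u}, X → Prop) :
    WtopEvIsoM.{u} p Q :=
  wtopEvIsoM_of_towers (isoQuadraticTowerTerminates_of_algIsolated p hP1 h3) hext Q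

end Summit.ResolutionOfSingularities.ResolutionOfSingularities.Cruxes.SigmaMaxModifications.IdeasL1C4
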